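import Summits.KontsevichZagierPeriods.KontsevichZagierPeriods.Theses.SymplecticScissors
import Literature.NumberTheory.Transcendental.KZPeriodsProofs
import Literature.NumberTheory.Transcendental.CurvePeriodsStokesProofs

/-!
# `PlanarK0Injective` (stmt-KontsevichZagierPeriods-9847) — negative side: formal independence of period
symbols is not cheaper than numerical independence (line `mordell-weil-normal-form`, stubs 3 (3) / 5)

Refuter (`drefute`, 2026-08-16) by-product for the crux `PlanarK0Injective` of route `SymplecticScissors`.
Nothing here refutes the crux. The lead's skeleton `Cruxes/PlanarK0Injective/Lines/mordell-weil-normal-form.lean`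
certifies independence of the normal-basis areas in one of three shapes; shape (3) asks for period symbols
`t j` (`CurvePeriods.PeriodSymbol`) with real periods `v j` and their FORMAL INDEPENDENCE — no non-trivial
`ℚ̄`-combination of the `single (t j)` is a `ℚ̄`-combination of the elementary relations R1–R5 of
`CurvePeriods.lean` — and the stub `stub_huberWustholz : HuberWustholzCurvePeriods` turns it into numerical
independence. Here:

* `formalIndependent_of_valueIndependent` — UNCONDITIONALLY (the soundness of R1–R5 is the tree's proved
  `CurvePeriods.IsElementaryRelation.evalCombination_eq_zero`, `CurvePeriodsStokesProofs.lean`), numerical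
  `ℚ̄ ∩ ℝ`-independence of the real periods (shape (1) of the stub) implies formal independence (shape (3));
* `valueIndependent_of_formalIndependent` — the converse modulo `HuberWustholzCurvePeriods` (the skeleton's
  `valueIndependent_of_symbols`, restated);
* `formalIndependent_iff_valueIndependent` — so, modulo HW, shape (3) ⇔ shape (1); and shape (1) ⇒ shape (3)
  needs nothing.

Consequence for the line: shape (3) is logically WEAKER than shape (1) and the composition must pay
`HuberWustholzCurvePeriods` to use it; but the only way to ESTABLISH shape (3) for a concrete family in this tree
is through shape (1) (`evalCombination` is the only invariant of `span (R1–R5)` available — a motivic computation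
of the rendered formal period space would need de Rham / singular (co)homology of curve pairs and the dimension
theory of 1-motives, none of it in the tree), so the Huber–Wüstholz stub is a round trip and never lowers the
obligation of `stub_mordellWeilNormalForm`. What a non-toric family needs is HW in INDEPENDENCE form
(Thm 9.10 / Thm 15.3 dimension formula, p. 145), not the generation-form fact.
[Huber–Wüstholz 2022, Thm 13.3 (2) p. 121, Thm 9.10, Thm 15.3 p. 145]
-/

noncomputable section

open Literature.NumberTheory.Transcendental

namespace Summit.KontsevichZagierPeriods.SymplecticScissors.PlanarK0InjectiveNegative

/-- Finite sums of symbols evaluate termwise. [folklore] -/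
theorem evalCombination_finset_sum {ι : Type*} (s : Finset ι)
    (f : ι → (CurvePeriods.PeriodSymbol →₀ ℂ)) :
    CurvePeriods.evalCombination (∑ i ∈ s, f i) = ∑ i ∈ s, CurvePeriods.evalCombination (f i) := by
  classical
  refine Finset.induction_on s ?_ ?_
  · simp [CurvePeriods.evalCombination]
  · intro a s ha ih
    rw [Finset.sum_insert ha, Finset.sum_insert ha, CurvePeriods.evalCombination_add, ih]

/-- **Shape (1) ⇒ shape (3), unconditionally.** If the real numbers `v j` are the periods of the symbols
`t j` and are linearly independent over the real algebraic numbers, then the symbols are formally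
independent: evaluate a putative formal relation (elementary relations evaluate to `0`,
`CurvePeriods.IsElementaryRelation.evalCombination_eq_zero`), and split the resulting complex `ℚ̄`-relation
among the real `v j` into real and imaginary parts. [folklore] -/
theorem formalIndependent_of_valueIndependent {m : ℕ}
    (v : Fin m → ℝ) (t : Fin m → CurvePeriods.PeriodSymbol)
    (hreal : ∀ j, ((v j : ℝ) : ℂ) = (t j).period)
    (hVI : (∀ μ : Fin m → ℝ, (∀ j, IsAlgebraic ℚ (μ j)) → ∑ j, μ j * v j = 0 → ∀ j, μ j = 0)) :
    (∀ a : Fin m → ℂ, (∀ j, IsAlgebraic ℚ (a j)) →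
      (∃ (l : ℕ) (ρ : Fin l → (CurvePeriods.PeriodSymbol →₀ ℂ)) (w : Fin l → ℂ),
        (∀ i, CurvePeriods.IsElementaryRelation (ρ i)) ∧ (∀ i, IsAlgebraic ℚ (w i)) ∧
        ∑ j, a j • Finsupp.single (t j) (1 : ℂ) = ∑ i, w i • ρ i) → ∀ j, a j = 0) := by
  intro a ha hex j
  obtain ⟨l, ρ, w, hρ, -, hsum⟩ := hex
  have hev := congrArg CurvePeriods.evalCombination hsum
  rw [evalCombination_finset_sum, evalCombination_finset_sum] at hev
  have hL : ∀ j, CurvePeriods.evalCombination (a j • Finsupp.single (t j) (1 : ℂ)) =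
      a j * ((v j : ℝ) : ℂ) := fun j => by
    rw [CurvePeriods.evalCombination_smul, CurvePeriods.evalCombination_single, ← hreal j, one_mul]
  have hR : ∀ i, CurvePeriods.evalCombination (w i • ρ i) = 0 := fun i => by
    rw [CurvePeriods.evalCombination_smul, (hρ i).evalCombination_eq_zero, mul_zero]
  simp_rw [hL, hR] at hev
  rw [Finset.sum_const_zero] at hev
  have hre : ∑ j, (a j).re * v j = 0 := by
    have := congrArg Complex.re hev
    simpa [Complex.re_sum, Complex.mul_re] using this
  have him : ∑ j, (a j).im * v j = 0 := by
    have := congrArg Complex.im hev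
    simpa [Complex.im_sum, Complex.mul_im] using this
  have h1 := hVI (fun j => (a j).re) (fun j => (isAlgebraic_re_im (ha j)).1) hre j
  have h2 := hVI (fun j => (a j).im) (fun j => (isAlgebraic_re_im (ha j)).2) him j
  exact Complex.ext (by simpa using h1) (by simpa using h2)

/-- **Shape (3) ⇒ shape (1), modulo `HuberWustholzCurvePeriods`** (the skeleton's
`valueIndependent_of_symbols`, restated): a real algebraic relation among the periods is a vanishing
`ℚ̄`-combination of symbols, hence (HW) a combination of elementary relations, hence trivial. [folklore] -/
theorem valueIndependent_of_formalIndependent (hHW : HuberWustholzCurvePeriods) {m : ℕ}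
    (v : Fin m → ℝ) (t : Fin m → CurvePeriods.PeriodSymbol)
    (hreal : ∀ j, ((v j : ℝ) : ℂ) = (t j).period)
    (hFI : (∀ a : Fin m → ℂ, (∀ j, IsAlgebraic ℚ (a j)) →
      (∃ (l : ℕ) (ρ : Fin l → (CurvePeriods.PeriodSymbol →₀ ℂ)) (w : Fin l → ℂ),
        (∀ i, CurvePeriods.IsElementaryRelation (ρ i)) ∧ (∀ i, IsAlgebraic ℚ (w i)) ∧
        ∑ j, a j • Finsupp.single (t j) (1 : ℂ) = ∑ i, w i • ρ i) → ∀ j, a j = 0)) :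
    (∀ μ : Fin m → ℝ, (∀ j, IsAlgebraic ℚ (μ j)) → ∑ j, μ j * v j = 0 → ∀ j, μ j = 0) := by
  intro μ hμ hsum j
  classical
  set a : Fin m → ℂ := fun j => ((μ j : ℝ) : ℂ) with ha
  have halg : ∀ j, IsAlgebraic ℚ (a j) := fun j => (hμ j).algebraMap
  set c : CurvePeriods.PeriodSymbol →₀ ℂ := ∑ j, a j • Finsupp.single (t j) (1 : ℂ) with hc
  have hcoef : ∀ s, IsAlgebraic ℚ (c s) := by
    intro s
    rw [← mem_algebraicClosure_iff]
    simp only [hc, Finsupp.coe_finsetSum, Finset.sum_apply, Finsupp.coe_smul, Pi.smul_apply,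
      smul_eq_mul]
    refine Subalgebra.sum_mem _ fun j _ => Subalgebra.mul_mem _ (mem_algebraicClosure_iff.mpr (halg j)) ?_
    rw [Finsupp.single_apply]
    split_ifs
    · exact Subalgebra.one_mem _
    · exact Subalgebra.zero_mem _
  have heval : CurvePeriods.evalCombination c = 0 := by
    rw [hc, evalCombination_finset_sum]
    have : ∀ j, CurvePeriods.evalCombination (a j • Finsupp.single (t j) (1 : ℂ)) =
        ((μ j * v j : ℝ) : ℂ) := fun j => by
      rw [CurvePeriods.evalCombination_smul, CurvePeriods.evalCombination_single, ← hreal j]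
      push_cast
      simp [ha]
    simp_rw [this]
    rw [← Complex.ofReal_sum, hsum, Complex.ofReal_zero]
  obtain ⟨l, ρ, w, hρ, hw, hcw⟩ := hHW c hcoef heval
  have h0 := hFI a halg ⟨l, ρ, w, hρ, hw, by rw [← hcw]⟩ j
  simpa [ha] using h0

/-- **Shape (3) ⇔ shape (1) modulo HW** (and (1) ⇒ (3) needs nothing). For the line
`mordell-weil-normal-form` this means the stub `stub_huberWustholz` is a round trip: formal independence is
in practice discharged through numerical independence, which is what the composition wants. [folklore] -/
theorem formalIndependent_iff_valueIndependent (hHW : HuberWustholzCurvePeriods) {m : ℕ} (v : Fin m → ℝ)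
    (t : Fin m → CurvePeriods.PeriodSymbol) (hreal : ∀ j, ((v j : ℝ) : ℂ) = (t j).period) :
    (∀ a : Fin m → ℂ, (∀ j, IsAlgebraic ℚ (a j)) →
      (∃ (l : ℕ) (ρ : Fin l → (CurvePeriods.PeriodSymbol →₀ ℂ)) (w : Fin l → ℂ),
        (∀ i, CurvePeriods.IsElementaryRelation (ρ i)) ∧ (∀ i, IsAlgebraic ℚ (w i)) ∧
        ∑ j, a j • Finsupp.single (t j) (1 : ℂ) = ∑ i, w i • ρ i) → ∀ j, a j = 0) ↔
    (∀ μ : Fin m → ℝ, (∀ j, IsAlgebraic ℚ (μ j)) → ∑ j, μ j * v j = 0 → ∀ j, μ j = 0) :=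
  ⟨valueIndependent_of_formalIndependent hHW v t hreal,
    formalIndependent_of_valueIndependent v t hreal⟩

end Summit.KontsevichZagierPeriods.SymplecticScissors.PlanarK0InjectiveNegative

end
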